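import Summits.BirchSwinnertonDyer.BirchSwinnertonDyer.Theorems.AdditiveKolyvaginRoadLocalPackage
import Summits.BirchSwinnertonDyer.BirchSwinnertonDyer.Theorems.AdditiveKolyvaginRoadLocalDictionaries
import Summits.BirchSwinnertonDyer.BirchSwinnertonDyer.Theorems.AdditiveKolyvaginRoadInductionOfLevelSystemsDict
import Summits.BirchSwinnertonDyer.BirchSwinnertonDyer.Theorems.AdditiveKolyvaginRoadKolyvaginSignedSupply
import HarnessLib

/-!
# Route `AdditiveKolyvaginRoad`, crux `LevelKolyvaginSystemsAdditive` (item stmt-BirchSwinnertonDyer-21396, KS′):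
# the (Lower) half of the Kolyvagin dichotomy for the level Selmer spaces TRANSVERSE on `m`, FROM THE LOCAL–GLOBAL PACKAGE
# (cell `pub/bsd-wall`, lead prover `cruxlead-stmt-BirchSwinnertonDyer-21396` g2; `--supports stmt-BirchSwinnertonDyer-21396`,
# helper; discharges binder (K)-(Lower) of `…LevelSystemsOfSelmerDichotomy` from `KolyvaginLocalPackageP` — itself landed modulo
# the named Poitou–Tate fact, `kolyvaginLocalPackageP_of_poitouTate`)

WHAT. `selmerDichotomy_lower_of_localPackage`: for any family `𝒮 n m μ ≤ H¹(K, E[p])` with the membership dictionary of the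
level-`n` `μ`-eigen Selmer space of `E[p]` transverse on the Kolyvagin primes of `m` (finite-dimensional), a Kolyvagin prime
`ℓ ∉ m` with place `v ∋ ℓ`, and a class `x₀ ∈ 𝒮 n m μ` NOT locally trivial at `v`: (i) every class of `𝒮 n (m ∪ ℓ) μ` is
locally trivial at `v` — (Perf) pairs `x₀` (Kummer at `v`, non-zero there) non-trivially with a transverse class non-zero at `v`,
while (REC) with the isotropies (Kummer everywhere else, TORIC above `n`, TRANSVERSE above `m`) makes that local term vanish;
(ii) `dim 𝒮 n (m ∪ ℓ) μ + 1 = dim 𝒮 n m μ` — `𝒮 n (m ∪ ℓ) μ = 𝒮 n m μ ∩ ker loc_v` by (i) and the dictionary, and `loc_v` maps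
`𝒮 n m μ` ONTO a line ((Line): the Kummer eigen-line; non-zero by `x₀`), so rank–nullity. This is Mazur–Rubin's «how to use
Kolyvagin primes» in the route's currency, for the structures with transverse conditions; E-side.

HONEST FRAMING: one theorem; 0 definitions, 0 named facts, 0 `sorry`; CONDITIONAL on the package `KolyvaginLocalPackageP`
(hypothesis; in the tree modulo Poitou–Tate); closes nothing. BSD is not proved by any of this.

References: [cite: MazurRubin2004, Lemma 4.1.7] [cite: WZhang2014, §8.1, Lemma 8.1, Lemma 8.4] [cite: GrossLMS1991, Prop. 6.2,
Prop. 8.2] [cite: MilneADT2006, Ch. I, Thm. 4.10].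
-/

-- single-conjunct summit: `Summit.BirchSwinnertonDyer.BirchSwinnertonDyer.…` repeats the name by design
set_option linter.dupNamespace false

noncomputable section

open scoped Classical

namespace Summit.BirchSwinnertonDyer.BirchSwinnertonDyer.Theorems.AdditiveKoly

open WeierstrassCurve NumberField IsDedekindDomain
  Literature.NumberTheory.EllipticCurves Literature.NumberTheory.EllipticCurves.ModularForms
  Literature.NumberTheory.GaloisRepresentations Module
  Summit.BirchSwinnertonDyer.Rank1Residual.X11b.Three.Koly.Method2

variable (W : WeierstrassCurve ℚ) (K : Type) [Field K] [NumberField K] (p : ℕ)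
  [W.IsElliptic] [W.IsGloballyMinimal] [Fact p.Prime]
  (ι : K →+* ℂ) (c : K ≃ₐ[ℚ] K)
  [Module (ZMod p) (Vp W K p)]
  [∀ v : Place K, Module (ZMod p)
    (galoisCohomology (((W.baseChange K).torsionGaloisModule ((p ^ 1 : ℕ) : ℤ)).toLocal v) 1)]

/-- **(Lower) for the transverse level spaces, from the local–global package.** Given the package `Lp`, a family `𝒮` with the
membership dictionary (finite-dimensional), a Kolyvagin prime `ℓ ∉ m`, its place `v`, and `x₀ ∈ 𝒮 n m μ` not locally trivial
at `v`: every class of `𝒮 n (m ∪ ℓ) μ` is locally trivial at `v`, and `dim 𝒮 n (m ∪ ℓ) μ + 1 = dim 𝒮 n m μ`.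
[cite: MazurRubin2004, Lemma 4.1.7] [cite: WZhang2014, Lemma 8.4, §8.1] -/
theorem selmerDichotomy_lower_of_localPackage (Lp : KolyvaginLocalPackageP W K p ι c)
    (𝒮 : Finset (AdmQ W K p) → Finset {ℓ // Zhang2014.IsKolyvaginPrime (W.conductorNorm ℤ) W K p ℓ} → Bool →
      Submodule (ZMod p) (Vp W K p))
    (h𝒮 : ∀ (n : Finset (AdmQ W K p)) (m : Finset {ℓ // Zhang2014.IsKolyvaginPrime (W.conductorNorm ℤ) W K p ℓ})
      (μ : Bool) (x : Vp W K p), x ∈ 𝒮 n m μ ↔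
        conjAct W c ((p ^ 1 : ℕ) : ℤ) x = sgnP μ • x ∧
        (∀ w : InfinitePlace K, x ∈ selmerLocalKer (W.baseChange K) w.Completion ((p ^ 1 : ℕ) : ℤ)) ∧
        (∀ v : HeightOneSpectrum (𝓞 K), (∀ ℓ ∈ m, ((ℓ : ℕ) : 𝓞 K) ∉ v.asIdeal) → (∀ q ∈ n, ((q : ℕ) : 𝓞 K) ∉ v.asIdeal) →
          x ∈ selmerLocalKer (W.baseChange K) (v.adicCompletion K) ((p ^ 1 : ℕ) : ℤ)) ∧
        (∀ q ∈ n, ∀ v : HeightOneSpectrum (𝓞 K), ((q : ℕ) : 𝓞 K) ∈ v.asIdeal →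
          x ∈ toricLocalKer (W.baseChange K) (v.adicCompletion K) ((p ^ 1 : ℕ) : ℤ)) ∧
        (∀ ℓ ∈ m, ∀ v : HeightOneSpectrum (𝓞 K), ((ℓ : ℕ) : 𝓞 K) ∈ v.asIdeal → x ∈ transverseLocalKerP W K p ι ℓ v))
    (hfin : ∀ n m μ, Module.Finite (ZMod p) (𝒮 n m μ)) :
    ∀ (n : Finset (AdmQ W K p)) (m : Finset {ℓ // Zhang2014.IsKolyvaginPrime (W.conductorNorm ℤ) W K p ℓ})
      (ℓ : {ℓ // Zhang2014.IsKolyvaginPrime (W.conductorNorm ℤ) W K p ℓ}) (μ : Bool) (v : HeightOneSpectrum (𝓞 K)),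
      ℓ ∉ m → ((ℓ : ℕ) : 𝓞 K) ∈ v.asIdeal →
      (∃ x ∈ 𝒮 n m μ, x ∉ (W.baseChange K).torsionLocalKer (v.adicCompletion K) ((p ^ 1 : ℕ) : ℤ)) →
      (∀ y ∈ 𝒮 n (insert ℓ m) μ, y ∈ (W.baseChange K).torsionLocalKer (v.adicCompletion K) ((p ^ 1 : ℕ) : ℤ)) ∧
        finrank (ZMod p) (𝒮 n (insert ℓ m) μ) + 1 = finrank (ZMod p) (𝒮 n m μ) := by
  intro n m ℓ μ v hℓm hv hx
  obtain ⟨x₀, hx₀, hx₀Z⟩ := hx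
  have hp : p.Prime := Fact.out
  -- the genuine localisation at `v` as a `ZMod p`-linear map, and the dictionaries
  let ρ := (W.baseChange K).torsionGaloisModule ((p ^ 1 : ℕ) : ℤ)
  let loc : Vp W K p →ₗ[ZMod p] galoisCohomology (ρ.toLocal (Sum.inr v)) 1 :=
    (show Vp W K p →+ galoisCohomology (ρ.toLocal (Sum.inr v)) 1 from galoisCohomology.localization ρ (Sum.inr v) 1).toZModLinearMap p
  have hloc : ∀ x : Vp W K p, loc x = galoisCohomology.localization ρ (Sum.inr v) 1 x := fun _ ↦ rfl
  have hKumFin := mem_selmerLocalKer_iff_localization_mem_kummer_P W K p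
  have hKumInf := mem_selmerLocalKer_iff_localization_mem_kummer_inf_P W K p
  have hZero := mem_torsionLocalKer_iff_localization_eq_zero_P W K p
  -- `v` is THE place above `ℓ`: it lies above no prime of `n ∪ m`, and no other place contains `ℓ`
  let plK : {ℓ // Zhang2014.IsKolyvaginPrime (W.conductorNorm ℤ) W K p ℓ} → HeightOneSpectrum (𝓞 K) := fun ℓ ↦
    ⟨Ideal.span {((ℓ : ℕ) : 𝓞 K)}, ℓ.2.2.2.2.2.1, by
      rw [Ne, Ideal.span_singleton_eq_bot]; exact_mod_cast ℓ.2.1.ne_zero⟩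
  have hplK : ∀ ℓ, ((ℓ : ℕ) : 𝓞 K) ∈ (plK ℓ).asIdeal := fun ℓ ↦ Ideal.mem_span_singleton_self _
  have hcur := ne_plK_iff_not_mem W K p plK hplK
  have hveq : v = plK ℓ := by
    by_contra hne
    exact (hcur ℓ v).mp hne hv
  have hvn : ∀ q ∈ n, ((q : ℕ) : 𝓞 K) ∉ v.asIdeal := fun q _ ↦ not_mem_of_kolyvagin_place_P W K p q ℓ.2 v hv
  have hvm : ∀ ℓ' ∈ m, ((ℓ' : ℕ) : 𝓞 K) ∉ v.asIdeal := by
    intro ℓ' hℓ' h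
    by_cases heq : (ℓ' : ℕ) = ℓ
    · exact hℓm (Subtype.ext heq ▸ hℓ')
    · exact not_mem_asIdeal_of_coprime K ((Nat.coprime_primes ℓ.2.1 ℓ'.2.1).mpr (Ne.symm heq)) v hv h
  obtain ⟨hxs, hxinf, hxoff, hxtor, hxtr⟩ := (h𝒮 n m μ x₀).mp hx₀
  have hxK : x₀ ∈ selmerLocalKer (W.baseChange K) (v.adicCompletion K) ((p ^ 1 : ℕ) : ℤ) := hxoff v hvm hvn
  -- (i) every class of `𝒮 n (m ∪ ℓ) μ` is locally trivial at `v`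
  have hi : ∀ y ∈ 𝒮 n (insert ℓ m) μ, y ∈ (W.baseChange K).torsionLocalKer (v.adicCompletion K) ((p ^ 1 : ℕ) : ℤ) := by
    intro y hy
    by_contra hyZ
    obtain ⟨hys, hyinf, hyoff, hytor, hytr⟩ := (h𝒮 n (insert ℓ m) μ y).mp hy
    have hyT : y ∈ transverseLocalKerP W K p ι ℓ v := hytr ℓ (Finset.mem_insert_self _ _) v hv
    have hperf := Lp.perf ℓ ℓ.2 v hv μ x₀ y hxs hys hxK hx₀Z hyT hyZ
    refine hperf ?_
    have hrec := Lp.reciprocity x₀ y {Sum.inr v} (fun w hw ↦ ?_)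
    · rwa [Finset.sum_singleton] at hrec
    rcases w with w | v'
    · exact Lp.isoKummer (Sum.inl w) _ ((hKumInf w x₀).mp (hxinf w)) _ ((hKumInf w y).mp (hyinf w))
    · have hv' : v' ≠ v := fun h ↦ hw (by rw [h, Finset.mem_singleton])
      by_cases hq : ∃ q ∈ n, ((q : ℕ) : 𝓞 K) ∈ v'.asIdeal
      · obtain ⟨q, hq, hqv'⟩ := hq
        exact Lp.isoToric q v' hqv' x₀ y (hxtor q hq v' hqv') (hytor q hq v' hqv')
      · push Not at hq
        by_cases hl : ∃ ℓ' ∈ m, ((ℓ' : ℕ) : 𝓞 K) ∈ v'.asIdeal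
        · obtain ⟨ℓ', hℓ', hℓ'v⟩ := hl
          exact Lp.isoTransverse ℓ' ℓ'.2 v' hℓ'v x₀ y (hxtr ℓ' hℓ' v' hℓ'v)
            (hytr ℓ' (Finset.mem_insert_of_mem hℓ') v' hℓ'v)
        · push Not at hl
          have hℓv' : ((ℓ : ℕ) : 𝓞 K) ∉ v'.asIdeal := (hcur ℓ v').mp (by rw [← hveq]; exact hv')
          have hyK' : y ∈ selmerLocalKer (W.baseChange K) (v'.adicCompletion K) ((p ^ 1 : ℕ) : ℤ) := by
            refine hyoff v' (fun ℓ'' hℓ'' ↦ ?_) hq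
            rcases Finset.mem_insert.mp hℓ'' with rfl | h
            · exact hℓv'
            · exact hl ℓ'' h
          exact Lp.isoKummer (Sum.inr v') _ ((hKumFin v' x₀).mp (hxoff v' hl hq)) _ ((hKumFin v' y).mp hyK')
  refine ⟨hi, ?_⟩
  -- (ii) the dimension count: `𝒮 n (m ∪ ℓ) μ = 𝒮 n m μ ∩ ker loc_v`, and `loc_v (𝒮 n m μ)` is a line
  let Zv : Submodule (ZMod p) (Vp W K p) :=
    AddSubgroup.toZModSubmodule p ((W.baseChange K).torsionLocalKer (v.adicCompletion K) ((p ^ 1 : ℕ) : ℤ))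
  have hZv : ∀ x, x ∈ Zv ↔ x ∈ (W.baseChange K).torsionLocalKer (v.adicCompletion K) ((p ^ 1 : ℕ) : ℤ) :=
    fun x ↦ AddSubgroup.mem_toZModSubmodule p
  have heq : 𝒮 n (insert ℓ m) μ = 𝒮 n m μ ⊓ Zv := by
    ext y
    rw [Submodule.mem_inf, hZv]
    constructor
    · intro hy
      obtain ⟨hys, hyinf, hyoff, hytor, hytr⟩ := (h𝒮 n (insert ℓ m) μ y).mp hy
      refine ⟨(h𝒮 n m μ y).mpr ⟨hys, hyinf, fun v' hv'm hv'n ↦ ?_, hytor,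
        fun ℓ' hℓ' v' hv' ↦ hytr ℓ' (Finset.mem_insert_of_mem hℓ') v' hv'⟩, hi y hy⟩
      by_cases hℓv' : ((ℓ : ℕ) : 𝓞 K) ∈ v'.asIdeal
      · have h1 : v' = v := by
          rw [hveq]
          by_contra hne
          exact (hcur ℓ v').mp hne hℓv'
        rw [h1]
        exact (W.baseChange K).torsionLocalKer_le_selmerLocalKer _ _ (hi y hy)
      · refine hyoff v' (fun ℓ'' hℓ'' ↦ ?_) hv'n
        rcases Finset.mem_insert.mp hℓ'' with rfl | h
        · exact hℓv'
        · exact hv'm ℓ'' h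
    · rintro ⟨hy, hyZ⟩
      obtain ⟨hys, hyinf, hyoff, hytor, hytr⟩ := (h𝒮 n m μ y).mp hy
      refine (h𝒮 n (insert ℓ m) μ y).mpr ⟨hys, hyinf, fun v' hv'm hv'n ↦ hyoff v'
        (fun ℓ'' hℓ'' ↦ hv'm ℓ'' (Finset.mem_insert_of_mem hℓ'')) hv'n, hytor, fun ℓ' hℓ' v' hv' ↦ ?_⟩
      rcases Finset.mem_insert.mp hℓ' with rfl | h
      · have h1 : v' = v := by
          rw [hveq]
          by_contra hne
          exact (hcur _ v').mp hne hv'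
        rw [h1]
        exact torsionLocalKer_le_transverseLocalKerP W K p ι _ v hyZ
      · exact hytr ℓ' h v' hv'
  -- rank–nullity for `loc_v` restricted to `𝒮 n m μ`
  haveI := hfin n m μ
  let ψ : 𝒮 n m μ →ₗ[ZMod p] galoisCohomology (ρ.toLocal (Sum.inr v)) 1 := loc.domRestrict (𝒮 n m μ)
  have hψ : ∀ x : 𝒮 n m μ, ψ x = galoisCohomology.localization ρ (Sum.inr v) 1 (x : Vp W K p) := fun _ ↦ rfl
  have hker : LinearMap.ker ψ = Submodule.comap (𝒮 n m μ).subtype Zv := by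
    ext ⟨y, hy⟩
    rw [LinearMap.mem_ker, Submodule.mem_comap, Submodule.subtype_apply, hZv, hZero v y]
    exact Iff.rfl
  have hkerdim : finrank (ZMod p) (LinearMap.ker ψ) = finrank (ZMod p) (𝒮 n (insert ℓ m) μ) := by
    rw [hker, ← Submodule.finrank_map_subtype_eq (𝒮 n m μ) (Submodule.comap (𝒮 n m μ).subtype Zv),
      Submodule.map_comap_subtype, heq]
  -- the image is the Kummer eigen-line
  obtain ⟨e, he⟩ := Lp.line ℓ ℓ.2 v hv μ
  have hle : LinearMap.range ψ ≤ (ZMod p) ∙ e := by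
    rintro _ ⟨⟨x, hx⟩, rfl⟩
    obtain ⟨hxs', -, hxoff', -, -⟩ := (h𝒮 n m μ x).mp hx
    obtain ⟨a, ha⟩ := he x hxs' (hxoff' v hvm hvn)
    exact Submodule.mem_span_singleton.mpr ⟨a, by rw [hψ]; exact ha.symm⟩
  have hψx₀ : ψ ⟨x₀, hx₀⟩ ≠ 0 := fun h ↦ hx₀Z ((hZero v x₀).mpr ((hψ ⟨x₀, hx₀⟩).symm.trans h))
  have he0 : e ≠ 0 := by
    intro he0
    rw [he0, Submodule.span_zero_singleton] at hle
    exact hψx₀ ((Submodule.mem_bot (ZMod p)).mp (hle (LinearMap.mem_range_self ψ _)))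
  have hr1 : finrank (ZMod p) (LinearMap.range ψ) ≤ 1 := by
    calc finrank (ZMod p) (LinearMap.range ψ) ≤ finrank (ZMod p) ((ZMod p) ∙ e) := Submodule.finrank_mono hle
      _ = 1 := finrank_span_singleton he0
  have hr0 : finrank (ZMod p) (LinearMap.range ψ) ≠ 0 := by
    haveI : Module.Finite (ZMod p) (LinearMap.range ψ) := Module.Finite.of_injective
      (Submodule.inclusion hle) (Submodule.inclusion_injective hle)
    intro h0
    rw [Submodule.finrank_eq_zero] at h0
    exact hψx₀ ((Submodule.mem_bot (ZMod p)).mp (h0 ▸ LinearMap.mem_range_self ψ ⟨x₀, hx₀⟩))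
  have hrn := LinearMap.finrank_range_add_finrank_ker ψ
  omega

end Summit.BirchSwinnertonDyer.BirchSwinnertonDyer.Theorems.AdditiveKoly

end
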